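import Mathlib
import HarnessLib
import Literature.MathematicalPhysics.QuantumLattice.HubbardSliceSymbolSmoothMixedXi
import Literature.MathematicalPhysics.QuantumLattice.HubbardUVGridSymbolBand
import Summits.HubbardSuperconductivity.HubbardSuperconductivity.Theorems.KLProgrammeKLRegimeSliceSymbolTorusThird
import Summits.HubbardSuperconductivity.HubbardSuperconductivity.Theorems.KLProgrammeKLRegimeSliceSymbolIncrementLine

/-!
# Route `KLProgramme` — engine support (route (L2), weighted lines, cure (c-D)): the INCREMENT of the counterterm slice symbol between two frames
# `K, K′` ON THE SPACE-TIME DUAL TORUS — sup, space differences (orders 1–3) and time differences (orders 1–3), every bound carrying the piece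

Cell `gate-hubbard-kl`, seat hubbard-kl-k3c3-p2 (g8), for the ENGINE child stmt-HubbardSuperconductivity-20437 (`stub_engine_step_norms`, WEIGHTED lines at
internal levels; v2 conditional token #19; located risk «(b)-Wt@j≥1», evidence #48 CD-LIMITS).  For two frames `K, K′` with piece
`v := e_{K′} − e_K = frameLevel μ K′ − frameLevel μ K` (`|v| ≤ P₀`, `‖Dv‖ ≤ P₁`, `‖D²v‖ ≤ P₂`, `‖D³v‖ ≤ P₃`) and band `e_K` (`‖De_K‖ ≤ K₁ᵇ`,
`‖D²e_K‖ ≤ K₂ᵇ`, `‖D³e_K‖ ≤ K₃ᵇ`), the increment of the torus slice symbol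
`ΨΔ(q) = Ψ̂_{ω(q₁)}(e_{K′}(c(q₂))) − Ψ̂_{ω(q₁)}(e_K(c(q₂)))` (the symbol of `C^{K′}_{(Λ,Λ′]} − C^K_{(Λ,Λ′]}`) has

* §1 time-direction increments at orders 1, 2: `norm_fwdDiff_sliceSymbolFn_incr_le`, `norm_fwdDiff_iter_two_sliceSymbolFn_incr_le`
  (`‖Δ_δ^a[Ψ(ξ+y,·) − Ψ(ξ,·)](ω)‖ ≤ δ^a·M_a·|y|`; order 3 is Literature's `norm_fwdDiff_iter_three_sliceSymbolFn_incr_le`);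
* §2 **`norm_sliceSymbolTorusIncr_le`** (sup `≤ K₁^ΨP₀`), **`norm_fwdDiff_{one,two,three}_space_sliceSymbolTorusIncr_le`** (space differences along
  `(0, r̄)` = the continuum increment's line differences, `…SliceSymbolIncrementLine`); the TIME differences on the torus
  (`≤ (2π/β)^a·M_a·P₀` under `Λ′ < π(2M−5)/β`) are in the companion `…SliceSymbolTorusIncrementTime`.

These are the propagator inputs of the mixed master lemma for the `m`-th INCREMENT PIECE of the flow-piece telescoping.  Everything is proved; no
definitions, no named facts. [folklore]

References: G. Benfatto, A. Giuliani, V. Mastropietro, Ann. Henri Poincaré 7 (2006) 809–898, (2.36aa), Lemma 2.2, §3 (3.2)–(3.8); M. Salmhofer,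
*Renormalization* (1999), §4.2.5 (4.70)–(4.71).
-/

noncomputable section

namespace Summit.HubbardSuperconductivity.HubbardSuperconductivity.Theorems.TorusFourierL2

set_option linter.dupNamespace false -- summit = problem name (single-conjunct summit), D-0017

open Set Complex Finset Literature.MathematicalPhysics.QuantumLattice Literature.Probability.LatticeModels
open Summit.HubbardSuperconductivity.HubbardSuperconductivity.Theorems.DispersionFlow
open Summit.HubbardSuperconductivity.HubbardSuperconductivity.Theorems.PerturbedFermiCurve
open scoped Real

/-! ### §1 Time-direction increments at orders one and two -/

section Time

variable {c θ Λ Λ' ξ y : ℝ}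

/-- **First frequency difference of a band increment**: `‖Δ_δ[Ψ(ξ+y,·) − Ψ(ξ,·)](ω)‖ ≤ δ·(32B₂+128B₁+128)(c/Λ³)·|y|` (`δ ≥ 0`).
[cite: BenfattoGiulianiMastropietro2006, §3 (3.2)] -/
theorem norm_fwdDiff_sliceSymbolFn_incr_le (hΛ : 0 < Λ) (hΛΛ' : Λ ≤ Λ') (hθ : |θ| ≤ Λ / 4) (hc : 0 ≤ c) {B₁ B₂ B₃ B₄ : ℝ}
    (hB₁ : ∀ x, |deriv salmhoferCutoff x| ≤ B₁) (hB₂ : ∀ x, |deriv (deriv salmhoferCutoff) x| ≤ B₂)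
    (hB₃ : ∀ x, |deriv (deriv (deriv salmhoferCutoff)) x| ≤ B₃) (hB₄ : ∀ x, |deriv (deriv (deriv (deriv salmhoferCutoff))) x| ≤ B₄)
    {δ : ℝ} (hδ : 0 ≤ δ) (ω : ℝ) :
    ‖fwdDiff δ (fun t => sliceSymbolFn c θ Λ Λ' (ξ + y) t - sliceSymbolFn c θ Λ Λ' ξ t) ω‖ ≤
      δ * ((32 * B₂ + 128 * B₁ + 128) * c / Λ ^ 3 * |y|) := by
  rw [fwdDiff]
  exact Literature.Analysis.norm_sub_le_of_norm_deriv_le hδ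
    (f' := fun t => sliceSymbolFnD1 c θ Λ Λ' (ξ + y) t - sliceSymbolFnD1 c θ Λ Λ' ξ t)
    (fun t _ => (hasDerivAt_sliceSymbolFn hΛ hΛΛ' hθ t).sub (hasDerivAt_sliceSymbolFn hΛ hΛΛ' hθ t))
    fun _ _ => norm_sliceSymbolFnD1_sub_xi_le hΛ hΛΛ' hθ hc hB₁ hB₂ hB₃ hB₄ ξ y

/-- **Second frequency difference of a band increment**: `‖Δ_δ²[Ψ(ξ+y,·) − Ψ(ξ,·)](ω)‖ ≤ δ²·(64B₃+416B₂+1600B₁+1536)(c/Λ⁴)·|y|` (`δ ≥ 0`).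
[cite: BenfattoGiulianiMastropietro2006, §3 (3.2)] -/
theorem norm_fwdDiff_iter_two_sliceSymbolFn_incr_le (hΛ : 0 < Λ) (hΛΛ' : Λ ≤ Λ') (hθ : |θ| ≤ Λ / 4) (hc : 0 ≤ c) {B₁ B₂ B₃ B₄ : ℝ}
    (hB₁ : ∀ x, |deriv salmhoferCutoff x| ≤ B₁) (hB₂ : ∀ x, |deriv (deriv salmhoferCutoff) x| ≤ B₂)
    (hB₃ : ∀ x, |deriv (deriv (deriv salmhoferCutoff)) x| ≤ B₃) (hB₄ : ∀ x, |deriv (deriv (deriv (deriv salmhoferCutoff))) x| ≤ B₄)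
    {δ : ℝ} (hδ : 0 ≤ δ) (ω : ℝ) :
    ‖(fwdDiff δ)^[2] (fun t => sliceSymbolFn c θ Λ Λ' (ξ + y) t - sliceSymbolFn c θ Λ Λ' ξ t) ω‖ ≤
      δ ^ 2 * ((64 * B₃ + 416 * B₂ + 1600 * B₁ + 1536) * c / Λ ^ 4 * |y|) :=
  Literature.Analysis.norm_fwdDiff_iter_two_le hδ
    (f' := fun t => sliceSymbolFnD1 c θ Λ Λ' (ξ + y) t - sliceSymbolFnD1 c θ Λ Λ' ξ t)
    (f'' := fun t => sliceSymbolFnD2 c θ Λ Λ' (ξ + y) t - sliceSymbolFnD2 c θ Λ Λ' ξ t)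
    (fun t _ => (hasDerivAt_sliceSymbolFn hΛ hΛΛ' hθ t).sub (hasDerivAt_sliceSymbolFn hΛ hΛΛ' hθ t))
    (fun t _ => (hasDerivAt_sliceSymbolFnD1 hΛ hΛΛ' hθ t).sub (hasDerivAt_sliceSymbolFnD1 hΛ hΛΛ' hθ t))
    fun _ _ => norm_sliceSymbolFnD2_sub_xi_le hΛ hΛΛ' hθ hc hB₁ hB₂ hB₃ hB₄ ξ y

end Time

/-! ### §2 The increment on the product torus -/

section Torus

variable {L M : ℕ} [NeZero L] [NeZero M] {c Λ Λ' β μ : ℝ} {K K' : TrigPolyC4v}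

omit [NeZero L] [NeZero M] in
/-- The piece read through the torus: `e_{K′}(c(k)) − e_K(c(k)) = v(toLp c(k))`, `v = frameLevel μ K′ − frameLevel μ K`. [folklore] -/
theorem nambuXiCT_sub_eq (μ : ℝ) (K K' : TrigPolyC4v) (k : TorusSite 2 L) :
    nambuXiCT L μ K' k - nambuXiCT L μ K k =
      frameLevel μ K' (WithLp.toLp 2 (torusCentredMomentum L k)) - frameLevel μ K (WithLp.toLp 2 (torusCentredMomentum L k)) := by
  rw [PerturbedFermiCurve.nambuXiCT_eq_frameLevel L μ K' k, PerturbedFermiCurve.nambuXiCT_eq_frameLevel L μ K k]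

omit [NeZero L] in
/-- **Sup of the torus increment**: `‖ΨΔ(q)‖ ≤ (16B₁+16)(c/Λ²)·P₀` when `|e_{K′} − e_K| ≤ P₀`. [cite: BenfattoGiulianiMastropietro2006, §3 (3.2)] -/
theorem norm_sliceSymbolTorusIncr_le (hΛ : 0 < Λ) (hΛΛ' : Λ ≤ Λ') (hc : 0 ≤ c) {B₁ : ℝ} (hB₁ : ∀ x, |deriv salmhoferCutoff x| ≤ B₁)
    {P₀ : ℝ} (hv₀ : ∀ p, |frameLevel μ K' p - frameLevel μ K p| ≤ P₀) (q : TorusSite 1 (2 * M) × TorusSite 2 L) :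
    ‖sliceSymbolFnXi c 0 Λ Λ' (matsubaraFreq β M ⟨(q.1 0).val, ZMod.val_lt (q.1 0)⟩) (nambuXiCT L μ K' q.2) -
        sliceSymbolFnXi c 0 Λ Λ' (matsubaraFreq β M ⟨(q.1 0).val, ZMod.val_lt (q.1 0)⟩) (nambuXiCT L μ K q.2)‖ ≤
      (16 * B₁ + 16) * c / Λ ^ 2 * P₀ := by
  have hB10 : 0 ≤ B₁ := (abs_nonneg _).trans (hB₁ 0)
  have e : nambuXiCT L μ K' q.2 = nambuXiCT L μ K q.2 + (nambuXiCT L μ K' q.2 - nambuXiCT L μ K q.2) := by ring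
  rw [e]
  refine (norm_sliceSymbolFnXi_sub_le hΛ hΛΛ' (abs_zero_le_quarter hΛ) hc hB₁ _ _).trans (mul_le_mul_of_nonneg_left ?_ (by positivity))
  rw [nambuXiCT_sub_eq]; exact hv₀ _

/-- **Spatial differences of the torus increment are differences of the continuum increment**: for an integer vector `r`, every `N`,
`(Δ_{(0,r̄)})ᴺ ΨΔ (q) = (Δ_w)ᴺ [p ↦ Ψ̂_{ω(q₁)}(e_K(p) + v(p)) − Ψ̂_{ω(q₁)}(e_K(p))] (toLp c(q₂))`, `w = toLp((2π/L)r)`. [folklore] -/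
theorem fwdDiff_iter_space_sliceSymbolTorusIncr_eq (r : Fin 2 → ℤ) (N : ℕ) (q : TorusSite 1 (2 * M) × TorusSite 2 L) :
    ((fwdDiff ((0 : TorusSite 1 (2 * M)), (fun i => ((r i : ℤ) : ZMod L))))^[N]
        (fun q : TorusSite 1 (2 * M) × TorusSite 2 L =>
          sliceSymbolFnXi c 0 Λ Λ' (matsubaraFreq β M ⟨(q.1 0).val, ZMod.val_lt (q.1 0)⟩) (nambuXiCT L μ K' q.2) -
            sliceSymbolFnXi c 0 Λ Λ' (matsubaraFreq β M ⟨(q.1 0).val, ZMod.val_lt (q.1 0)⟩) (nambuXiCT L μ K q.2))) q =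
      ((fwdDiff (WithLp.toLp 2 (fun i => 2 * π / L * (r i : ℝ)) : EuclideanSpace ℝ (Fin 2)))^[N]
        (fun p : EuclideanSpace ℝ (Fin 2) =>
          sliceSymbolFnXi c 0 Λ Λ' (matsubaraFreq β M ⟨(q.1 0).val, ZMod.val_lt (q.1 0)⟩)
              (frameLevel μ K p + (frameLevel μ K' p - frameLevel μ K p)) -
            sliceSymbolFnXi c 0 Λ Λ' (matsubaraFreq β M ⟨(q.1 0).val, ZMod.val_lt (q.1 0)⟩) (frameLevel μ K p)))
        (WithLp.toLp 2 (torusCentredMomentum L q.2)) := by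
  have hsub₁ := fwdDiff_iter_sub ((0 : TorusSite 1 (2 * M)), (fun i => ((r i : ℤ) : ZMod L))) N
    (fun q : TorusSite 1 (2 * M) × TorusSite 2 L =>
      sliceSymbolFnXi c 0 Λ Λ' (matsubaraFreq β M ⟨(q.1 0).val, ZMod.val_lt (q.1 0)⟩) (nambuXiCT L μ K' q.2))
    (fun q : TorusSite 1 (2 * M) × TorusSite 2 L =>
      sliceSymbolFnXi c 0 Λ Λ' (matsubaraFreq β M ⟨(q.1 0).val, ZMod.val_lt (q.1 0)⟩) (nambuXiCT L μ K q.2))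
  have hsub₂ := fwdDiff_iter_sub (WithLp.toLp 2 (fun i => 2 * π / L * (r i : ℝ)) : EuclideanSpace ℝ (Fin 2)) N
    (fun p : EuclideanSpace ℝ (Fin 2) => sliceSymbolFnXi c 0 Λ Λ' (matsubaraFreq β M ⟨(q.1 0).val, ZMod.val_lt (q.1 0)⟩) (frameLevel μ K' p))
    (fun p : EuclideanSpace ℝ (Fin 2) => sliceSymbolFnXi c 0 Λ Λ' (matsubaraFreq β M ⟨(q.1 0).val, ZMod.val_lt (q.1 0)⟩) (frameLevel μ K p))
  have e₁ : (fun q : TorusSite 1 (2 * M) × TorusSite 2 L =>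
      sliceSymbolFnXi c 0 Λ Λ' (matsubaraFreq β M ⟨(q.1 0).val, ZMod.val_lt (q.1 0)⟩) (nambuXiCT L μ K' q.2) -
        sliceSymbolFnXi c 0 Λ Λ' (matsubaraFreq β M ⟨(q.1 0).val, ZMod.val_lt (q.1 0)⟩) (nambuXiCT L μ K q.2)) =
      (fun q : TorusSite 1 (2 * M) × TorusSite 2 L =>
        sliceSymbolFnXi c 0 Λ Λ' (matsubaraFreq β M ⟨(q.1 0).val, ZMod.val_lt (q.1 0)⟩) (nambuXiCT L μ K' q.2)) -
      (fun q : TorusSite 1 (2 * M) × TorusSite 2 L =>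
        sliceSymbolFnXi c 0 Λ Λ' (matsubaraFreq β M ⟨(q.1 0).val, ZMod.val_lt (q.1 0)⟩) (nambuXiCT L μ K q.2)) := by
    funext q; rfl
  have e₂ : (fun p : EuclideanSpace ℝ (Fin 2) =>
      sliceSymbolFnXi c 0 Λ Λ' (matsubaraFreq β M ⟨(q.1 0).val, ZMod.val_lt (q.1 0)⟩) (frameLevel μ K p + (frameLevel μ K' p - frameLevel μ K p)) -
        sliceSymbolFnXi c 0 Λ Λ' (matsubaraFreq β M ⟨(q.1 0).val, ZMod.val_lt (q.1 0)⟩) (frameLevel μ K p)) =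
      (fun p : EuclideanSpace ℝ (Fin 2) => sliceSymbolFnXi c 0 Λ Λ' (matsubaraFreq β M ⟨(q.1 0).val, ZMod.val_lt (q.1 0)⟩) (frameLevel μ K' p)) -
      (fun p : EuclideanSpace ℝ (Fin 2) => sliceSymbolFnXi c 0 Λ Λ' (matsubaraFreq β M ⟨(q.1 0).val, ZMod.val_lt (q.1 0)⟩) (frameLevel μ K p)) := by
    funext p; simp only [Pi.sub_apply, add_sub_cancel]
  rw [e₁, hsub₁, e₂, hsub₂, Pi.sub_apply, Pi.sub_apply, fwdDiff_iter_space_sliceSymbolTorus_eq, fwdDiff_iter_space_sliceSymbolTorus_eq]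

/-- The frame band is `C³`. [folklore] -/
theorem contDiff_three_frameLevel (μ : ℝ) (K : TrigPolyC4v) : ContDiff ℝ 3 (frameLevel μ K) := EngineV8.contDiff_frameLevel μ K

/-- The piece `e_{K′} − e_K` is `C³`. [folklore] -/
theorem contDiff_three_frameLevel_sub (μ : ℝ) (K K' : TrigPolyC4v) : ContDiff ℝ 3 (fun p => frameLevel μ K' p - frameLevel μ K p) :=
  (EngineV8.contDiff_frameLevel μ K').sub (EngineV8.contDiff_frameLevel μ K)

/-- **First spatial difference of the torus increment** along `(0, r̄)` (`w = toLp((2π/L)r)`):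
`≤ K₂^Ψ·P₀·(K₁ᵇ‖w‖ + P₁‖w‖) + K₁^Ψ·P₁‖w‖`. [cite: BenfattoGiulianiMastropietro2006, §3 (3.2)] -/
theorem norm_fwdDiff_one_space_sliceSymbolTorusIncr_le {Kb₁ P₀ P₁ : ℝ} (hb₁ : ∀ p, ‖fderiv ℝ (frameLevel μ K) p‖ ≤ Kb₁)
    (hv₀ : ∀ p, |frameLevel μ K' p - frameLevel μ K p| ≤ P₀) (hv₁ : ∀ p, ‖fderiv ℝ (fun p => frameLevel μ K' p - frameLevel μ K p) p‖ ≤ P₁)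
    (hΛ : 0 < Λ) (hΛΛ' : Λ ≤ Λ') (hc : 0 ≤ c) {B₁ B₂ : ℝ} (hB₁ : ∀ x, |deriv salmhoferCutoff x| ≤ B₁)
    (hB₂ : ∀ x, |deriv (deriv salmhoferCutoff) x| ≤ B₂) (r : Fin 2 → ℤ) (q : TorusSite 1 (2 * M) × TorusSite 2 L) :
    ‖fwdDiff ((0 : TorusSite 1 (2 * M)), (fun i => ((r i : ℤ) : ZMod L)))
        (fun q : TorusSite 1 (2 * M) × TorusSite 2 L =>
          sliceSymbolFnXi c 0 Λ Λ' (matsubaraFreq β M ⟨(q.1 0).val, ZMod.val_lt (q.1 0)⟩) (nambuXiCT L μ K' q.2) -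
            sliceSymbolFnXi c 0 Λ Λ' (matsubaraFreq β M ⟨(q.1 0).val, ZMod.val_lt (q.1 0)⟩) (nambuXiCT L μ K q.2)) q‖ ≤
      (32 * B₂ + 144 * B₁ + 128) * c / Λ ^ 3 * P₀ *
          (Kb₁ * ‖(WithLp.toLp 2 (fun i => 2 * π / L * (r i : ℝ)) : EuclideanSpace ℝ (Fin 2))‖ +
            P₁ * ‖(WithLp.toLp 2 (fun i => 2 * π / L * (r i : ℝ)) : EuclideanSpace ℝ (Fin 2))‖) +
        (16 * B₁ + 16) * c / Λ ^ 2 * (P₁ * ‖(WithLp.toLp 2 (fun i => 2 * π / L * (r i : ℝ)) : EuclideanSpace ℝ (Fin 2))‖) := by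
  have h := fwdDiff_iter_space_sliceSymbolTorusIncr_eq (c := c) (Λ := Λ) (Λ' := Λ') (β := β) (μ := μ) (K := K) (K' := K') r 1 q
  simp only [Function.iterate_one] at h
  rw [h]
  exact norm_fwdDiff_sliceSymbol_incr_line_le (contDiff_three_frameLevel μ K) (contDiff_three_frameLevel_sub μ K K') hb₁ hv₀ hv₁
    hΛ hΛΛ' hc hB₁ hB₂ _ _

/-- **Second spatial difference of the torus increment** along `(0, r̄)`. [cite: BenfattoGiulianiMastropietro2006, §3 (3.2)] -/
theorem norm_fwdDiff_two_space_sliceSymbolTorusIncr_le {Kb₁ Kb₂ P₀ P₁ P₂ : ℝ} (hb₁ : ∀ p, ‖fderiv ℝ (frameLevel μ K) p‖ ≤ Kb₁)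
    (hb₂ : ∀ p, ‖iteratedFDeriv ℝ 2 (frameLevel μ K) p‖ ≤ Kb₂)
    (hv₀ : ∀ p, |frameLevel μ K' p - frameLevel μ K p| ≤ P₀) (hv₁ : ∀ p, ‖fderiv ℝ (fun p => frameLevel μ K' p - frameLevel μ K p) p‖ ≤ P₁)
    (hv₂ : ∀ p, ‖iteratedFDeriv ℝ 2 (fun p => frameLevel μ K' p - frameLevel μ K p) p‖ ≤ P₂)
    (hΛ : 0 < Λ) (hΛΛ' : Λ ≤ Λ') (hc : 0 ≤ c) {B₁ B₂ B₃ : ℝ} (hB₁ : ∀ x, |deriv salmhoferCutoff x| ≤ B₁)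
    (hB₂ : ∀ x, |deriv (deriv salmhoferCutoff) x| ≤ B₂) (hB₃ : ∀ x, |deriv (deriv (deriv salmhoferCutoff)) x| ≤ B₃)
    (r : Fin 2 → ℤ) (q : TorusSite 1 (2 * M) × TorusSite 2 L) :
    ‖((fwdDiff ((0 : TorusSite 1 (2 * M)), (fun i => ((r i : ℤ) : ZMod L))))^[2]
        (fun q : TorusSite 1 (2 * M) × TorusSite 2 L =>
          sliceSymbolFnXi c 0 Λ Λ' (matsubaraFreq β M ⟨(q.1 0).val, ZMod.val_lt (q.1 0)⟩) (nambuXiCT L μ K' q.2) -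
            sliceSymbolFnXi c 0 Λ Λ' (matsubaraFreq β M ⟨(q.1 0).val, ZMod.val_lt (q.1 0)⟩) (nambuXiCT L μ K q.2))) q‖ ≤
      (64 * B₃ + 480 * B₂ + 1728 * B₁ + 1536) * c / Λ ^ 4 * P₀ *
          (Kb₁ * ‖(WithLp.toLp 2 (fun i => 2 * π / L * (r i : ℝ)) : EuclideanSpace ℝ (Fin 2))‖ +
            P₁ * ‖(WithLp.toLp 2 (fun i => 2 * π / L * (r i : ℝ)) : EuclideanSpace ℝ (Fin 2))‖) ^ 2 +
        (32 * B₂ + 144 * B₁ + 128) * c / Λ ^ 3 *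
          (P₁ * ‖(WithLp.toLp 2 (fun i => 2 * π / L * (r i : ℝ)) : EuclideanSpace ℝ (Fin 2))‖ *
            (2 * (Kb₁ * ‖(WithLp.toLp 2 (fun i => 2 * π / L * (r i : ℝ)) : EuclideanSpace ℝ (Fin 2))‖) +
              P₁ * ‖(WithLp.toLp 2 (fun i => 2 * π / L * (r i : ℝ)) : EuclideanSpace ℝ (Fin 2))‖)) +
        ((32 * B₂ + 144 * B₁ + 128) * c / Λ ^ 3 * P₀ *
            (Kb₂ * ‖(WithLp.toLp 2 (fun i => 2 * π / L * (r i : ℝ)) : EuclideanSpace ℝ (Fin 2))‖ ^ 2 +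
              P₂ * ‖(WithLp.toLp 2 (fun i => 2 * π / L * (r i : ℝ)) : EuclideanSpace ℝ (Fin 2))‖ ^ 2) +
          (16 * B₁ + 16) * c / Λ ^ 2 * (P₂ * ‖(WithLp.toLp 2 (fun i => 2 * π / L * (r i : ℝ)) : EuclideanSpace ℝ (Fin 2))‖ ^ 2)) := by
  rw [fwdDiff_iter_space_sliceSymbolTorusIncr_eq]
  exact norm_fwdDiff_two_sliceSymbol_incr_line_le (contDiff_three_frameLevel μ K) (contDiff_three_frameLevel_sub μ K K') hb₁ hb₂ hv₀ hv₁ hv₂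
    hΛ hΛΛ' hc hB₁ hB₂ hB₃ _ _

/-- **Third spatial difference of the torus increment** along `(0, r̄)`. [cite: BenfattoGiulianiMastropietro2006, §3 (3.2)] -/
theorem norm_fwdDiff_three_space_sliceSymbolTorusIncr_le {Kb₁ Kb₂ Kb₃ P₀ P₁ P₂ P₃ : ℝ} (hb₁ : ∀ p, ‖fderiv ℝ (frameLevel μ K) p‖ ≤ Kb₁)
    (hb₂ : ∀ p, ‖iteratedFDeriv ℝ 2 (frameLevel μ K) p‖ ≤ Kb₂) (hb₃ : ∀ p, ‖iteratedFDeriv ℝ 3 (frameLevel μ K) p‖ ≤ Kb₃)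
    (hv₀ : ∀ p, |frameLevel μ K' p - frameLevel μ K p| ≤ P₀) (hv₁ : ∀ p, ‖fderiv ℝ (fun p => frameLevel μ K' p - frameLevel μ K p) p‖ ≤ P₁)
    (hv₂ : ∀ p, ‖iteratedFDeriv ℝ 2 (fun p => frameLevel μ K' p - frameLevel μ K p) p‖ ≤ P₂)
    (hv₃ : ∀ p, ‖iteratedFDeriv ℝ 3 (fun p => frameLevel μ K' p - frameLevel μ K p) p‖ ≤ P₃)
    (hΛ : 0 < Λ) (hΛΛ' : Λ ≤ Λ') (hc : 0 ≤ c) {B₁ B₂ B₃ B₄ : ℝ} (hB₁ : ∀ x, |deriv salmhoferCutoff x| ≤ B₁)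
    (hB₂ : ∀ x, |deriv (deriv salmhoferCutoff) x| ≤ B₂) (hB₃ : ∀ x, |deriv (deriv (deriv salmhoferCutoff)) x| ≤ B₃)
    (hB₄ : ∀ x, |deriv (deriv (deriv (deriv salmhoferCutoff))) x| ≤ B₄) (r : Fin 2 → ℤ) (q : TorusSite 1 (2 * M) × TorusSite 2 L) :
    ‖((fwdDiff ((0 : TorusSite 1 (2 * M)), (fun i => ((r i : ℤ) : ZMod L))))^[3]
        (fun q : TorusSite 1 (2 * M) × TorusSite 2 L =>
          sliceSymbolFnXi c 0 Λ Λ' (matsubaraFreq β M ⟨(q.1 0).val, ZMod.val_lt (q.1 0)⟩) (nambuXiCT L μ K' q.2) -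
            sliceSymbolFnXi c 0 Λ Λ' (matsubaraFreq β M ⟨(q.1 0).val, ZMod.val_lt (q.1 0)⟩) (nambuXiCT L μ K q.2))) q‖ ≤
      (128 * B₄ + 1408 * B₃ + 7776 * B₂ + 27648 * B₁ + 24576) * c / Λ ^ 5 * P₀ *
          (Kb₁ * ‖(WithLp.toLp 2 (fun i => 2 * π / L * (r i : ℝ)) : EuclideanSpace ℝ (Fin 2))‖ +
            P₁ * ‖(WithLp.toLp 2 (fun i => 2 * π / L * (r i : ℝ)) : EuclideanSpace ℝ (Fin 2))‖) ^ 3 +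
        (64 * B₃ + 480 * B₂ + 1728 * B₁ + 1536) * c / Λ ^ 4 *
          (P₁ * ‖(WithLp.toLp 2 (fun i => 2 * π / L * (r i : ℝ)) : EuclideanSpace ℝ (Fin 2))‖ *
            (3 * (Kb₁ * ‖(WithLp.toLp 2 (fun i => 2 * π / L * (r i : ℝ)) : EuclideanSpace ℝ (Fin 2))‖) ^ 2 +
              3 * (Kb₁ * ‖(WithLp.toLp 2 (fun i => 2 * π / L * (r i : ℝ)) : EuclideanSpace ℝ (Fin 2))‖) *
                (P₁ * ‖(WithLp.toLp 2 (fun i => 2 * π / L * (r i : ℝ)) : EuclideanSpace ℝ (Fin 2))‖) +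
              (P₁ * ‖(WithLp.toLp 2 (fun i => 2 * π / L * (r i : ℝ)) : EuclideanSpace ℝ (Fin 2))‖) ^ 2)) +
        3 * ((64 * B₃ + 480 * B₂ + 1728 * B₁ + 1536) * c / Λ ^ 4 * P₀ *
            ((Kb₁ * ‖(WithLp.toLp 2 (fun i => 2 * π / L * (r i : ℝ)) : EuclideanSpace ℝ (Fin 2))‖ +
                P₁ * ‖(WithLp.toLp 2 (fun i => 2 * π / L * (r i : ℝ)) : EuclideanSpace ℝ (Fin 2))‖) *
              (Kb₂ * ‖(WithLp.toLp 2 (fun i => 2 * π / L * (r i : ℝ)) : EuclideanSpace ℝ (Fin 2))‖ ^ 2 +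
                P₂ * ‖(WithLp.toLp 2 (fun i => 2 * π / L * (r i : ℝ)) : EuclideanSpace ℝ (Fin 2))‖ ^ 2)) +
          (32 * B₂ + 144 * B₁ + 128) * c / Λ ^ 3 *
            (Kb₁ * ‖(WithLp.toLp 2 (fun i => 2 * π / L * (r i : ℝ)) : EuclideanSpace ℝ (Fin 2))‖ *
                (P₂ * ‖(WithLp.toLp 2 (fun i => 2 * π / L * (r i : ℝ)) : EuclideanSpace ℝ (Fin 2))‖ ^ 2) +
              P₁ * ‖(WithLp.toLp 2 (fun i => 2 * π / L * (r i : ℝ)) : EuclideanSpace ℝ (Fin 2))‖ *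
                (Kb₂ * ‖(WithLp.toLp 2 (fun i => 2 * π / L * (r i : ℝ)) : EuclideanSpace ℝ (Fin 2))‖ ^ 2) +
              P₁ * ‖(WithLp.toLp 2 (fun i => 2 * π / L * (r i : ℝ)) : EuclideanSpace ℝ (Fin 2))‖ *
                (P₂ * ‖(WithLp.toLp 2 (fun i => 2 * π / L * (r i : ℝ)) : EuclideanSpace ℝ (Fin 2))‖ ^ 2))) +
        ((32 * B₂ + 144 * B₁ + 128) * c / Λ ^ 3 * P₀ *
            (Kb₃ * ‖(WithLp.toLp 2 (fun i => 2 * π / L * (r i : ℝ)) : EuclideanSpace ℝ (Fin 2))‖ ^ 3 +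
              P₃ * ‖(WithLp.toLp 2 (fun i => 2 * π / L * (r i : ℝ)) : EuclideanSpace ℝ (Fin 2))‖ ^ 3) +
          (16 * B₁ + 16) * c / Λ ^ 2 * (P₃ * ‖(WithLp.toLp 2 (fun i => 2 * π / L * (r i : ℝ)) : EuclideanSpace ℝ (Fin 2))‖ ^ 3)) := by
  rw [fwdDiff_iter_space_sliceSymbolTorusIncr_eq]
  exact norm_fwdDiff_three_sliceSymbol_incr_line_le (contDiff_three_frameLevel μ K) (contDiff_three_frameLevel_sub μ K K') hb₁ hb₂ hb₃
    hv₀ hv₁ hv₂ hv₃ hΛ hΛΛ' hc hB₁ hB₂ hB₃ hB₄ _ _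

end Torus

end Summit.HubbardSuperconductivity.HubbardSuperconductivity.Theorems.TorusFourierL2

end
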